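import Summits.Ventures.CertifiedManyBodySolver.Rows.DopedTLCorr
import HarnessLib

/-!
# `D₄`-orbit-mean correlator cells at the ORIGIN are the plain cells

HONEST FRAMING: first certified bounds; not a superconductivity verdict; every number certified or
labelled float.

`Rows/DopedTLCorr.lean` types the honest conclusion of a point-group-REDUCED TL correlator certificate as
the `D₄`-ORBIT-MEAN cell `SquareTTPrimeCorrOrbitLowerRow tp U n u r S Λ X`
(`r ≤ |S|⁻¹ Σ_{γ ∈ S} Re ω_{γΛ}(Γ(d4Emb γ 0 Λ) X)`), because a torus limit of sector ground states need
not be `D₄`-invariant. For an observable supported AT THE ORIGIN, `Λ = {0}` — the double occupancy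
`n_{0↑} n_{0↓}` (`doccAt0 2`) of the M3′ docc rows (CERTIFIED #257 / #261) is the case at hand — no
invariance of the STATE is needed: every `γ ∈ D₄` fixes the origin (`d4Vec γ 0 = 0`, the action is
linear; `d4Vec_eq_zero_iff`, cf. `Transport.d4Vec_zero`), so the affine image region `γ·{0} + 0` is `{0}` itself, the relabelling `d4Emb γ 0 {0}` is the
isotony inclusion, and `ω_{γ{0}}(Γ(d4Emb γ 0 {0}) X) = ω_{{0}}(X)` for EVERY infinite-volume state `ω` by
the compatibility of its local functionals (`InfVolFermionState.compatible`). Hence the orbit mean over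
any non-empty label set `S` equals `Re ω(X)` and the orbit cell is EQUIVALENT to the plain cell
(`squareTTPrimeCorrOrbitLowerRow_origin_iff`; pattern of the landed `…_singleton_one_iff` for `S = {1}`
and of `SquareTTPrimeCorrOrbitLowerRow.lowerRow_of_invariant`).

Consequences typed here (solver-free, no certificate read): `M3CorrOrbitLowerRow tp u r S {0} (doccAt0 2)
→ M3DoccLowerRow tp u r` and `M3CorrOrbitLowerRow tp u q S {0} (−doccAt0 2) → M3DoccUpperRow tp u (−q)`,
so a `Certificates/` file can restate a `D₄`-reduced docc window as the PLAIN two-sided docc window its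
CERTIFIED row prints (done for #257 / #261 in `Certificates/HubbardSquare_n7o8_corr_docc_rows257_261_plain.lean`).

NOTHING IS ASSERTED: every bound-valued statement takes row predicates as hypotheses. No `sorry`, no new
axiom, no named fact, no new row predicate. (lit-1 gen-9, sr-mbsolver, 2026-08-21; CLAIM HOME/INBOX l.3129.)
-/

noncomputable section

namespace Summit.Ventures.CertifiedManyBodySolver

open Literature.MathematicalPhysics.QuantumLattice
open Matrix HubbardWave0 Literature.Probability.LatticeModels ThermodynamicLimit Filter Topology
open scoped BigOperators

/-! ## Every `γ ∈ D₄` fixes the origin -/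

/-- The origin lies in its affine `D₄` image `γ·{0} + 0` (indeed equals it). -/
theorem origin_subset_d4ShiftSet (γ : DihedralGroup 4) :
    ({0} : Finset (Site 2)) ⊆ d4ShiftSet γ 0 ({0} : Finset (Site 2)) := by
  intro x hx
  rw [Finset.mem_singleton] at hx
  subst hx
  have h := d4Vec_add_mem_d4ShiftSet γ (0 : Site 2) (Finset.mem_singleton_self (0 : Site 2))
  rwa [(d4Vec_eq_zero_iff γ 0).2 rfl, add_zero] at h

/-- On the one-site region `{0}` the affine map `d4Emb γ 0 {0}` IS the isotony inclusion
`{0} ⊆ γ·{0} + 0`. -/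
theorem d4Emb_origin_apply (γ : DihedralGroup 4) (y : PolySite ({0} : Finset (Site 2))) :
    PolySite.d4Emb γ 0 ({0} : Finset (Site 2)) y = PolySite.incl (origin_subset_d4ShiftSet γ) y := by
  have hy : ofLex y.1 = (0 : Site 2) := Finset.mem_singleton.1 (PolySite.ofLex_mem y)
  refine Subtype.ext ?_
  show toLex (d4Vec γ (ofLex y.1) + 0) = y.1
  rw [hy, (d4Vec_eq_zero_iff γ 0).2 rfl, add_zero]
  exact (congrArg toLex hy).symm

/-- `Γ(d4Emb γ 0 {0}) = Γ(incl)` on operators supported at the origin. -/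
theorem fermionEmbed_d4Emb_origin (γ : DihedralGroup 4) (X : FermionOp ({0} : Finset (Site 2))) :
    fermionEmbed (PolySite.d4Emb γ 0 ({0} : Finset (Site 2))) X =
      fermionEmbed (PolySite.incl (origin_subset_d4ShiftSet γ)) X := by
  rw [fermionEmbed_congr (fun y => d4Emb_origin_apply γ y)]

/-- **Every infinite-volume state takes the same value on the `γ`-image of an origin observable as on
the observable**: `ω_{γ{0}}(Γ(d4Emb γ 0 {0}) X) = ω_{{0}}(X)` for all `ω`, all `γ ∈ D₄`, all `X ∈ 𝔄_{{0}}`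
(compatibility of the local functionals along the inclusion; no symmetry of `ω` is used). -/
theorem expect_d4ShiftSet_origin (ω : InfVolFermionState 2) (γ : DihedralGroup 4)
    (X : FermionOp ({0} : Finset (Site 2))) :
    ω.expect (d4ShiftSet γ 0 ({0} : Finset (Site 2))) (fermionEmbed (PolySite.d4Emb γ 0 ({0} : Finset (Site 2))) X) =
      ω.expect ({0} : Finset (Site 2)) X := by
  rw [fermionEmbed_d4Emb_origin, ω.compatible]

/-- Hence the `D₄`-orbit mean of an origin observable over any non-empty label set is its plain value. -/
theorem orbitMean_origin (ω : InfVolFermionState 2) {S : Finset (DihedralGroup 4)} (hS : S.Nonempty)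
    (X : FermionOp ({0} : Finset (Site 2))) :
    (S.card : ℝ)⁻¹ * ∑ g ∈ S, (ω.expect (d4ShiftSet g 0 ({0} : Finset (Site 2)))
        (fermionEmbed (PolySite.d4Emb g 0 ({0} : Finset (Site 2))) X)).re =
      (ω.expect ({0} : Finset (Site 2)) X).re := by
  have hsum : ∑ g ∈ S, (ω.expect (d4ShiftSet g 0 ({0} : Finset (Site 2)))
      (fermionEmbed (PolySite.d4Emb g 0 ({0} : Finset (Site 2))) X)).re =
      ∑ g ∈ S, (ω.expect ({0} : Finset (Site 2)) X).re :=
    Finset.sum_congr rfl fun g _ => by rw [expect_d4ShiftSet_origin ω g X]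
  have hc : (S.card : ℝ) ≠ 0 := by exact_mod_cast hS.card_pos.ne'
  rw [hsum, Finset.sum_const, nsmul_eq_mul, ← mul_assoc, inv_mul_cancel₀ hc, one_mul]

/-! ## Orbit cells at the origin are the plain cells -/

section Square

variable {tp U n : ℝ} {u r : ℚ} {S : Finset (DihedralGroup 4)} {X : FermionOp ({0} : Finset (Site 2))}

/-- **An ORBIT-MEAN lower cell on the origin region IS the plain lower cell** (any non-empty label set
`S ⊆ D₄`; no invariance of the states in the class is needed). -/
theorem squareTTPrimeCorrOrbitLowerRow_origin_iff (hS : S.Nonempty) :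
    SquareTTPrimeCorrOrbitLowerRow tp U n u r S ({0} : Finset (Site 2)) X ↔
      SquareTTPrimeCorrLowerRow tp U n u r ({0} : Finset (Site 2)) X := by
  constructor
  · intro h ω Ls ψ hLs hψ hψ1 hω hu
    have hh := h ω Ls ψ hLs hψ hψ1 hω hu
    rwa [orbitMean_origin ω hS X] at hh
  · intro h ω Ls ψ hLs hψ hψ1 hω hu
    rw [orbitMean_origin ω hS X]
    exact h ω Ls ψ hLs hψ hψ1 hω hu

/-- The orbit-mean lower cell at the origin gives the plain lower cell. -/
theorem SquareTTPrimeCorrOrbitLowerRow.lowerRow_origin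
    (h : SquareTTPrimeCorrOrbitLowerRow tp U n u r S ({0} : Finset (Site 2)) X) (hS : S.Nonempty) :
    SquareTTPrimeCorrLowerRow tp U n u r ({0} : Finset (Site 2)) X :=
  (squareTTPrimeCorrOrbitLowerRow_origin_iff hS).1 h

/-- The orbit-mean lower cell at the origin for the NEGATED objective gives the plain UPPER cell
(`SquareTTPrimeCorrUpperRow.of_lower_neg`): `q ≤ orbit-mean Re ω(−X)` ⇒ `Re ω(X) ≤ −q`. -/
theorem SquareTTPrimeCorrOrbitLowerRow.upperRow_origin_neg {q : ℚ}
    (h : SquareTTPrimeCorrOrbitLowerRow tp U n u q S ({0} : Finset (Site 2)) (-X)) (hS : S.Nonempty) :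
    SquareTTPrimeCorrUpperRow tp U n u (-q) ({0} : Finset (Site 2)) X :=
  SquareTTPrimeCorrUpperRow.of_lower_neg (by rw [neg_neg]; exact h.lowerRow_origin hS)

/-! ## The M3′ double-occupancy cells -/

/-- A `D₄`-reduced docc FLOOR certificate at the M3′ point (orbit cell on `{0}` with the word
`doccAt0 2`) types the plain cell `M3DoccLowerRow tp u r`: `r ≤ Re ω(n_{0↑}n_{0↓})` given `e₀ ≤ u`. -/
theorem M3CorrOrbitLowerRow.doccLowerRow
    (h : M3CorrOrbitLowerRow tp u r S ({0} : Finset (Site 2)) (doccAt0 2)) (hS : S.Nonempty) :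
    M3DoccLowerRow tp u r :=
  SquareTTPrimeCorrOrbitLowerRow.lowerRow_origin h hS

/-- A `D₄`-reduced docc CEILING certificate at the M3′ point (orbit cell on `{0}` with the literal
negated word `−doccAt0 2` and certified constant `q`, typically `q < 0`) types the plain cell
`M3DoccUpperRow tp u (−q)`: `Re ω(n_{0↑}n_{0↓}) ≤ −q` given `e₀ ≤ u`. -/
theorem M3CorrOrbitLowerRow.doccUpperRow {q : ℚ}
    (h : M3CorrOrbitLowerRow tp u q S ({0} : Finset (Site 2)) (-(doccAt0 2))) (hS : S.Nonempty) :
    M3DoccUpperRow tp u (-q) :=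
  SquareTTPrimeCorrOrbitLowerRow.upperRow_origin_neg h hS

/-- UNCONDITIONAL SHAPE of the plain two-sided docc window at the M3′ point: from an orbit floor node
(`r`), an orbit ceiling node on the negated word (`q`) and a typed energy upper row `M3EnergyUpperRow tp hi`
with `hi ≤ u`, `r ≤ Re ω(n_{0↑}n_{0↓}) ≤ −q` for EVERY torus limit of unit `(rectN (7/8) L, S^z = 0)`-sector
ground states of `hubbardTorusTT' L 1 tp 8` — no energy hypothesis and no orbit mean in the conclusion. -/
theorem M3CorrOrbitLowerRow.docc_window_uncond {q hi : ℚ}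
    (hlo : M3CorrOrbitLowerRow tp u r S ({0} : Finset (Site 2)) (doccAt0 2))
    (hup : M3CorrOrbitLowerRow tp u q S ({0} : Finset (Site 2)) (-(doccAt0 2))) (hS : S.Nonempty)
    (hE : M3EnergyUpperRow tp hi) (hhi : hi ≤ u) :
    ∀ (ω : InfVolFermionState 2) (Ls : ℕ → ℕ) (ψ : ∀ L, Fock (Orb (FermionTorus 2 L))),
      Tendsto Ls atTop atTop →
      (∀ j, IsGroundStateInSector (hubbardTorusTT' (Ls j) 1 tp 8) (rectN (7 / 8) (Ls j)) 0 (ψ (Ls j))) →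
      (∀ j, star (ψ (Ls j)) ⬝ᵥ ψ (Ls j) = 1) → ω.IsTorusLimitOf ψ Ls →
      ((r : ℚ) : ℝ) ≤ (ω.expect ({0} : Finset (Site 2)) (doccAt0 2)).re ∧
        (ω.expect ({0} : Finset (Site 2)) (doccAt0 2)).re ≤ (((-q : ℚ)) : ℝ) :=
  fun ω Ls ψ hLs hψ hψ1 hω =>
    ⟨M3CorrLowerRow.uncond (hlo.doccLowerRow hS) hE hhi ω Ls ψ hLs hψ hψ1 hω,
      M3CorrUpperRow.uncond (hup.doccUpperRow hS) hE hhi ω Ls ψ hLs hψ hψ1 hω⟩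

end Square

end Summit.Ventures.CertifiedManyBodySolver

end
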